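import Literature.Topology.FourManifolds.PairPsiHalf
import Literature.Topology.FourManifolds.PairPreExtExtension
import Literature.Topology.FourManifolds.ConeRadialExtension
import Literature.Topology.FourManifolds.SPC4HandlesProofs
import HarnessLib

/-!
# Extension over a compact `3`-manifold with boundary of boundary diffeomorphisms which are rigid
# near the traces of the co-cores of two gradient-like fields (two-field endgame of the Morse line
# for the Torelli half of Griffiths' handlebody theorem)

Topic `Literature/Topology/FourManifolds`; last file of the two-field series `BasinPair.lean`, …,
`PairPsiHalf.lean`, `PairPreExtExtension.lean`.  Everything here is **proved**; no named facts.

* `BasinPair.SaddleData.diffeoExtends_of_rigid` — **the two-field endgame theorem.**  Let `W` be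
  a compact `3`-manifold with boundary and `P : BasinPair g ξ_A ξ_B` a pair of basin settings
  (`g` Morse on `(W; ∅, ∂W)` with a unique critical point `p₀` of index `0`, two smooth
  gradient-like fields `ξ_A`, `ξ_B` sharing the radial Milnor chart at `p₀`) with saddle data
  `Q : P.SaddleData` (common saddle value, Milnor boxes of both fields at the saddles, a
  correspondence `σ` of the saddles).  Every self-diffeomorphism `χ` of `∂W` which maps the
  `ξ_A`-traces of the co-cores onto the `ξ_B`-traces and which, in flow-polar coordinates about
  the trace of every saddle `s` and of `σ s`, **is the model map** (`SaddleData.Rigid χ s δ` for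
  one width `δ > 0`) extends to a self-diffeomorphism of `W` (`BoundaryData.DiffeoExtends`).
  The extension is `pull_B ∘ Ψ₁ ∘ push_A`, where `Ψ₁` is the glued map `psi0` of `PairPsi.lean`
  — on the basin the level conjugation of `χ` from the `ξ_A`-flow to the `ξ_B`-flow, near the
  cores and the saddles the entrance/exit level transports and the model conjugations of the
  Milnor boxes — corrected inside a small ball about `p₀` by Cerf's radial extension of a Smale
  diffeotopy of the induced diffeomorphism of the sphere of directions
  (`ConeRadialExtension.lean`, `PairPreExtExtension.lean`).
* The one-field endgame `Cobordism.IsMorseFunction.diffeoExtends_of_eqOn_nhds_traces`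
  (`BasinEndgame.lean`) is the case `ξ_A = ξ_B`, `σ = id`, `χ = id` near the traces.

This is the form in which the wave/handle-slide normalisation of a based boundary
diffeomorphism acting trivially on `π₁` of a handlebody (changes of the gradient-like field by
Milnor's Lemma 4.7, then straightening near the meridians) is consumed: it ends with TWO
gradient-like fields for the same Morse function and a boundary map rigid near the traces.

## References

* H. B. Griffiths, *Automorphisms of a 3-dimensional handlebody*, Abh. Math. Sem. Univ. Hamburg
  26 (1964), main theorem and §§3–6. [GriffithsHB1964Handlebody]
* J. Milnor, *Lectures on the h-cobordism theorem* (1965), Def. 3.1, Thm. 4.1, proofs of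
  Thms. 3.12–3.13 (PDF pp. 12, 17–22). [MilnorHCobordism1965]
* J. Cerf, *Sur les difféomorphismes de la sphère de dimension trois (Γ₄ = 0)*, LNM 53 (1968),
  Ch. I §1, Lemme 2; Appendice §5, Théorème 4. [CerfDiffeoSphere1968]
-/

open scoped Manifold ContDiff Topology
open Set Function Filter Metric

noncomputable section

namespace Literature.Topology.FourManifolds

open Cobordism FourManifolds.Flow

universe u

/-! ### The two-field endgame theorem in dimension `3` -/

section Three

attribute [local instance] fact_finrank_euclideanSpace_succ

variable {W : Type u} [TopologicalSpace W] [T2Space W] [SecondCountableTopology W]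
  [CompactSpace W] [ChartedSpace (EuclideanHalfSpace (2 + 1)) W] [IsManifold (𝓡∂ (2 + 1)) ∞ W]
  [Nonempty (BoundaryManifold.boundaryData 2 W).carrier]
  {g : W → ℝ} {ξA ξB : Π x : W, TangentSpace (𝓡∂ (2 + 1)) x}

/-- **Extension of boundary diffeomorphisms rigid near the traces (two-field endgame,
dimension `3`).**  Let `P` be a pair of basin settings on a compact `3`-manifold with boundary
`W` (`g` Morse on `(W; ∅, ∂W)`, `ξ_A`, `ξ_B` gradient-like with the same unique minimum `p₀` and
a common radial chart there) and `Q` saddle data for `P` (common saddle value `c`, Milnor boxes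
of both fields, a correspondence `σ` of the saddles).  Every self-diffeomorphism `χ` of `∂W`
mapping the `ξ_A`-traces of the co-cores onto the `ξ_B`-traces (`hχ`) and rigid with a positive
width at every saddle — on the `ξ_A`-tops of the exit annulus of `s` the transport of `χ` is the
`ξ_B`-top of the model conjugation `MC s` of the boxes at `s` and `σ s` — extends to a
self-diffeomorphism of `W`. [cite: GriffithsHB1964Handlebody, main theorem and §§3–6] [cite: MilnorHCobordism1965, Thm. 4.1, proof of Thm. 3.13] [cite: CerfDiffeoSphere1968, Ch. I §1, Lemme 2; Appendice §5, Théorème 4] -/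
theorem BasinPair.SaddleData.diffeoExtends_of_rigid {P : BasinPair g ξA ξB} (Q : P.SaddleData)
    (χ : (𝓡∂ (2 + 1)).boundary W ≃ₘ⟮𝓡 2, 𝓡 2⟯ (𝓡∂ (2 + 1)).boundary W)
    (hχ : ∀ y, χ y ∈ P.B.traces ↔ y ∈ P.A.traces)
    {δR : ℝ} (hδR : 0 < δR) (hR : ∀ s, Q.Rigid χ s δR) :
    (BoundaryManifold.boundaryData 2 W).DiffeoExtends χ := by
  -- the inverse, and the properties of the pair
  set χ' : (𝓡∂ (2 + 1)).boundary W → (𝓡∂ (2 + 1)).boundary W := ⇑χ.symm with hχ'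
  have h1 : LeftInverse χ' χ := χ.symm_apply_apply
  have h2 : LeftInverse χ χ' := χ.apply_symm_apply
  have hχ'' : ∀ y, χ' y ∈ P.A.traces ↔ y ∈ P.B.traces := fun y => by
    have h := hχ (χ' y)
    rw [h2 y] at h
    exact h.symm
  -- admissible widths and the two halves
  obtain ⟨δ, ρ, hA⟩ := SaddleData.Adm.of_rigid hδR hR
  set E : P.PreHalf χ := Q.preHalf hA χ.contMDiff hχ with hE
  set E' : P.swap.PreHalf χ' := Q.swap.preHalf (hA.swap h1) χ.symm.contMDiff hχ'' with hE'
  have hinv : ∀ x, g x ∈ Ioo (g P.A.p₀) P.A.hi → E'.ψ (E.ψ x) = x := fun x hx =>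
    Q.psi0_swap_psi0 hA hχ h1 hx
  have hinv' : ∀ y, g y ∈ Ioo (g P.swap.A.p₀) P.swap.A.hi → E.ψ (E'.ψ y) = y := fun y hy =>
    SaddleData.psi0_psi0_swap hA hχ'' h1 h2 hy
  -- the diffeomorphism of the sphere of directions, and the cone diffeomorphism of `ℝ³`
  set φ := E.sphereDiffeo E' hinv hinv' with hφ
  obtain ⟨Θ, hΘn, hΘc⟩ := exists_diffeomorph_norm_eq_eq_cone_two φ P.A.rad_pos
  have hΘn' : ∀ v, ‖Θ.symm v‖ = ‖v‖ := fun v => by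
    conv_rhs => rw [← Θ.apply_symm_apply v]; rw [hΘn]
  have hΘc₁ : ∀ (t : ℝ) (u : Metric.sphere (0 : EuclideanSpace ℝ (Fin (2 + 1))) 1), P.A.rad / 2 ≤ t → t ≤ P.A.rad →
      Θ (t • (u : EuclideanSpace ℝ (Fin (2 + 1)))) =
        t • ((E.sphereMap u : Metric.sphere (0 : EuclideanSpace ℝ (Fin (2 + 1))) 1) : EuclideanSpace ℝ (Fin (2 + 1))) :=
    fun t u ht ht' => hΘc t u ht ht'
  have hΘc' : ∀ (t : ℝ) (u : Metric.sphere (0 : EuclideanSpace ℝ (Fin (2 + 1))) 1), P.swap.A.rad / 2 ≤ t →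
      t ≤ P.swap.A.rad → Θ.symm (t • (u : EuclideanSpace ℝ (Fin (2 + 1)))) =
        t • ((E'.sphereMap u : Metric.sphere (0 : EuclideanSpace ℝ (Fin (2 + 1))) 1) : EuclideanSpace ℝ (Fin (2 + 1))) := by
    intro t u ht ht'
    rw [BasinPair.PreHalf.rad_swap] at ht ht'
    have h := hΘc t (E'.sphereMap u) ht ht'
    have h3 : φ (E'.sphereMap u) = u := E'.sphereMap_sphereMap E hinv' u
    rw [h3] at h
    rw [← h, Θ.symm_apply_apply]
  set Ψ := E.extDiffeomorph E' hinv hinv' Θ Θ.symm Θ.symm_apply_apply Θ.apply_symm_apply Θ.contMDiff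
    Θ.symm.contMDiff hΘn hΘn' hΘc₁ hΘc' with hΨ
  refine ⟨Ψ, funext fun y => ?_⟩
  exact E.ext_coe y

/-- **Two-field endgame, per-saddle widths.**  As `diffeoExtends_of_rigid`, with a positive
rigidity width chosen saddle by saddle (there are finitely many saddles). [cite: GriffithsHB1964Handlebody, main theorem and §§3–6] -/
theorem BasinPair.SaddleData.diffeoExtends_of_forall_exists_rigid {P : BasinPair g ξA ξB} (Q : P.SaddleData)
    (χ : (𝓡∂ (2 + 1)).boundary W ≃ₘ⟮𝓡 2, 𝓡 2⟯ (𝓡∂ (2 + 1)).boundary W)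
    (hχ : ∀ y, χ y ∈ P.B.traces ↔ y ∈ P.A.traces)
    (hR : ∀ s, ∃ δ, 0 < δ ∧ Q.Rigid χ s δ) :
    (BoundaryManifold.boundaryData 2 W).DiffeoExtends χ := by
  classical
  have hfin : Finite (SaddlePt 2 g) := P.A.finite_saddlePt
  choose δ hδ0 hδ using hR
  rcases isEmpty_or_nonempty (SaddlePt 2 g) with h | h
  · exact Q.diffeoExtends_of_rigid χ hχ one_pos fun s => isEmptyElim s
  · obtain ⟨s₀, hs₀⟩ := Finite.exists_min δ
    exact Q.diffeoExtends_of_rigid χ hχ (hδ0 s₀) fun s => (hδ s).mono (hs₀ s)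

end Three

end Literature.Topology.FourManifolds
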